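import Summits.BirchSwinnertonDyer.Rank1Residual.Additive.SpecialJAnomalousFive
import Summits.BirchSwinnertonDyer.Rank1Residual.Additive.GordNonAnomalousThreeSix
import HarnessLib

/-!
# Defect-`4` (G)-pairs: the trace law `a = 2u`, `p = u² + v²`, and anomalous places only at `p = 5`

HONEST FRAMING (cell `b2b-bsdres`, run/shared/lean/b2b/bsd-rank1-residual/, verbatim in every
file): the goal of the cell is to DELETE the COMBINATION-SHAPED residual classes of the
Birch–Swinnerton-Dyer formula for ALL analytic-rank `≤ 1` elliptic curves over `ℚ` — "full BSD
formula for every rank `≤ 1` curve in class `C`" assembled STRICTLY from published theorems — so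
that the rank-`≤ 1` remainder becomes exactly the CONSTRUCTION-SHAPED classes, which are TYPED
(missing-input `Prop`s), NOT attempted. This is not "finishing BSD". Sub-cell `additive-p2`
(X3♯(G-ord) / X4♯(G-ord)), generation 35, part 3: research route; no claim beyond the stated
classes; theorems only, no definition, no named fact, nothing booked, no label moved.

## What is proved

The number-field / (G)-cell forms of parts 1–2 (`SpecialJTraceForm1728`, `SpecialJAnomalousFive`),
the defect-`4` companion of gen 34's `GordNonAnomalousThreeSix` (defect `3`/`6`, `a² + 3m² = 4p`) and
the sharpening of gen 11's `GordNonAnomalousFour` (`p ≥ 7`):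

* `exists_trace_eq_two_mul_and_sq_add_sq_reductionAt_of_valuation_j_sub_lt_one` — `V/F` good at a
  place `w` with `N(w) = p ≡ 1 (mod 4)` and `w(j(V) − 1728) < 1`: **`p + 1 − #Ṽ_w(k_w) = 2u`,
  `u² + v² = p`**; the anomalous form `eq_five_and_natCard_point_reductionAt_eq_ten_of_dvd_…`
  (`N(w) = p ≥ 5`, `p ∣ #Ṽ_w(k_w)` ⟹ `p = 5 ∧ #Ṽ_w(k_w) = 10`);
* `four_dvd_sub_one_of_typeG_of_semistabilityIndex_eq_four` — on the type-(G) locus defect `4` forces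
  `p ≡ 1 (mod 4)` (`e ∣ p − 1`);
* **`exists_trace_eq_two_mul_and_sq_add_sq_reductionAt_of_semistabilityIndex_eq_four`** — `W/ℚ`
  globally minimal, `e_E(p) = 4`, `p ≡ 1 (mod 4)`, ANY number field `F`, ANY place `w ∋ p` with
  `N(w) = p` at which `E_F` is good: **`p + 1 − #Ẽ_w(𝔽_p) = 2u` with `u² + v² = p`** (the census law
  LAW 3, 265/265 rows), norm form `(p + 1 − #Ẽ_w(𝔽_p))² + 4v² = 4p`;
* **`eq_five_and_natCard_point_reductionAt_eq_ten_of_dvd_of_semistabilityIndex_eq_four`** — a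
  defect-`4` pair is ANOMALOUS at a degree-one good place above `p ≥ 5` **only at `p = 5`, and then
  `#Ẽ_w(𝔽_5) = 10`** (gen 11: never at `p ≥ 7`); subfields of `ℚ(ζ_p)` (`…_intermediateField_…`), and
  at `p = 5`: `#Ẽ_w(𝔽_5) ∈ {2, 4, 8, 10}`, anomalous iff `= 10`
  (`natCard_point_reductionAt_mem_…_five`, `five_dvd_natCard_point_reductionAt_iff_…`);
* `reductionNonAnomalous_iff_forall_natCard_ne_ten_of_semistabilityIndex_eq_four` — at `p = 5`,
  Delbourgo's `ReductionNonAnomalous W 5` on a defect-`4` pair is EXACTLY "no good place above `5` of a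
  subfield of `ℚ(ζ_5)` has `#Ẽ_w(𝔽_5) = 10`" (one bit per pair; census 163/233 rows);
* **`exists_trace_sq_add_mul_sq_reductionAt_of_typeG`** — THE UNIFORM NORM-FORM LAW OF THE (G)-CELL
  OFF DEFECT `2`: for a type-(G) pair with `e_E(p) ∈ {3, 4, 6}` (`p ≥ 5`) and any degree-one good
  place `w ∋ p` of any number field, **`(p + 1 − #Ẽ_w(𝔽_p))² + d·m² = 4p` with `d = 3` (`3 ∣ e`) or
  `d = 4` (`e = 4`)** — the special fibre has CM by `ℤ[ω]` resp. `ℤ[i]` and its Frobenius is a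
  norm-`p` element (census: 599/599 defect-`3`/`4`/`6` rows; with gen 11's twist check on defect `2`,
  all 1280 (G-ord) traces over `F₀` are accounted for).

Census pointer (EVIDENCE, gen 11's `census/anom/anom_census.tsv` bc5ffe01…, re-read gen 35, zero
compute): defect `4`: 265 rows, `a_𝔭 = 2u`, `p = u² + v²` on 265/265; `p = 5`: 233 rows, traces
`−4: 70, −2: 64, 2: 51, 4: 48`, anomalous = the 70 rows with `a_𝔭 = −4`; `p ∈ {13, 17, 29, 37, 53}`:
32 rows, traces in `{±4, ±6}`, `{±2, ±8}`, `{±4, ±10}`, `{±2, ±12}`, `{±4, ±14}`, none anomalous.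

References: K. Ireland, M. Rosen, GTM 84, Ch. 18 §3 Thm. 4, §4 Thm. 5; B. Mazur, Invent. Math. 18
(1972) §5; R. Greenberg, LNM 1716 (1999) Thm. 4.1; D. Delbourgo, Compositio Math. 113 (1998) §1.5
(G); J. Number Theory 95 (2002) p. 39 (`ℓ_p(E)`); J. H. Silverman, *ATAEC* IV.9 Table 4.1.
-/

noncomputable section

open scoped Classical NumberField

open WeierstrassCurve IsDedekindDomain NumberField IsLocalRing
  Literature.NumberTheory.EllipticCurves Literature.NumberTheory.EllipticCurves.Rank1Residual
  Literature.NumberTheory.EllipticCurves.Rank1Residual.Typed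

namespace Summit.BirchSwinnertonDyer.Rank1Residual.Additive

/-! ### Number fields: degree-one good places with `j ≡ 1728` -/

section NumberFieldPlace

variable {F : Type} [Field F] [NumberField F] (V : WeierstrassCurve F) [V.IsElliptic]
  (w : HeightOneSpectrum (𝓞 F)) {p : ℕ}

/-- **The trace law at a degree-one place with `j ≡ 1728`**: for `V/F` good at a place `w` with
residue field `𝔽_p` (`N(w) = p`), `p ≡ 1 (mod 4)`, and `w(j(V) − 1728) < 1`, the reduced curve has
`j̃ = 1728` (`reductionAt_j_eq_of_valuation_lt_one`, gen 3) and **`p + 1 − #Ṽ_w(k_w) = 2u`,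
`u² + v² = p`** for some `u, v ∈ ℤ`. [cite: IrelandRosen1990, Ch. 18 §4, Theorem 5] -/
theorem exists_trace_eq_two_mul_and_sq_add_sq_reductionAt_of_valuation_j_sub_lt_one (hp : p.Prime)
    (hp1 : p % 4 = 1) (hN : Ideal.absNorm w.asIdeal = p) (hgood : V.HasGoodReductionAt w)
    (hj : w.valuation F (V.j - 1728) < 1) :
    ∃ u v : ℤ, ((p : ℤ) + 1 - Nat.card (V.reductionAt w).toAffine.Point) = 2 * u ∧
      u ^ 2 + v ^ 2 = p := by
  haveI : (V.reductionAt w).IsElliptic := isElliptic_reductionAt hgood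
  exact SpecialJ.exists_trace_eq_two_mul_and_sq_add_sq_of_j_eq (V.reductionAt w) hp hp1
    (natCard_residueField_adicCompletionIntegers_eq_of_absNorm w hN)
    (reductionAt_j_eq_of_valuation_lt_one V w hgood hj)

/-- Norm form: at a degree-one good place with `j ≡ 1728`, `N(w) = p ≡ 1 (mod 4)`,
**`(p + 1 − #Ṽ_w(k_w))² + 4v² = 4p`** for some `v ∈ ℤ`. [cite: IrelandRosen1990, Ch. 18 §4, Theorem 5] -/
theorem exists_trace_sq_add_four_mul_sq_reductionAt_of_valuation_j_sub_lt_one (hp : p.Prime)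
    (hp1 : p % 4 = 1) (hN : Ideal.absNorm w.asIdeal = p) (hgood : V.HasGoodReductionAt w)
    (hj : w.valuation F (V.j - 1728) < 1) :
    ∃ v : ℤ, ((p : ℤ) + 1 - Nat.card (V.reductionAt w).toAffine.Point) ^ 2 + 4 * v ^ 2 = 4 * p := by
  haveI : (V.reductionAt w).IsElliptic := isElliptic_reductionAt hgood
  exact SpecialJ.exists_trace_sq_add_four_mul_sq_of_j_eq (V.reductionAt w) hp hp1
    (natCard_residueField_adicCompletionIntegers_eq_of_absNorm w hN)
    (reductionAt_j_eq_of_valuation_lt_one V w hgood hj)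

/-- **Anomalous at a degree-one place with `j ≡ 1728` forces `p = 5` and `#Ṽ_w(k_w) = 10`**
(`N(w) = p ≥ 5`, `V` good at `w`, `w(j − 1728) < 1`, `p ∣ #Ṽ_w(k_w)`). Mazur 1972 §5; Ireland–Rosen
Ch. 18 §4 Thm. 5. [cite: IrelandRosen1990, Ch. 18 §4, Theorem 5] -/
theorem eq_five_and_natCard_point_reductionAt_eq_ten_of_dvd_of_valuation_j_sub_lt_one
    (hp : p.Prime) (hp5 : 5 ≤ p) (hN : Ideal.absNorm w.asIdeal = p) (hgood : V.HasGoodReductionAt w)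
    (hj : w.valuation F (V.j - 1728) < 1) (hdvd : p ∣ Nat.card (V.reductionAt w).toAffine.Point) :
    p = 5 ∧ Nat.card (V.reductionAt w).toAffine.Point = 10 := by
  haveI : (V.reductionAt w).IsElliptic := isElliptic_reductionAt hgood
  exact SpecialJ.eq_five_and_natCard_point_eq_ten_of_dvd_natCard_point_of_j_eq (V.reductionAt w)
    hp hp5 (natCard_residueField_adicCompletionIntegers_eq_of_absNorm w hN)
    (reductionAt_j_eq_of_valuation_lt_one V w hgood hj) hdvd

/-- **At a good place of norm `5` with `j ≡ 1728`: `#Ṽ_w(𝔽_5) ∈ {2, 4, 8, 10}`.**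
[cite: IrelandRosen1990, Ch. 18 §4, Theorem 5] -/
theorem natCard_point_reductionAt_mem_of_valuation_j_sub_lt_one_five
    (hN : Ideal.absNorm w.asIdeal = 5) (hgood : V.HasGoodReductionAt w)
    (hj : w.valuation F (V.j - 1728) < 1) :
    Nat.card (V.reductionAt w).toAffine.Point = 2 ∨ Nat.card (V.reductionAt w).toAffine.Point = 4 ∨
      Nat.card (V.reductionAt w).toAffine.Point = 8 ∨
        Nat.card (V.reductionAt w).toAffine.Point = 10 := by
  haveI : (V.reductionAt w).IsElliptic := isElliptic_reductionAt hgood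
  haveI : Fact (Nat.Prime 5) := ⟨by norm_num⟩
  exact SpecialJ.natCard_point_mem_of_j_eq_of_natCard_eq_five (V.reductionAt w)
    (natCard_residueField_adicCompletionIntegers_eq_of_absNorm w hN)
    (reductionAt_j_eq_of_valuation_lt_one V w hgood hj)

/-- **At a good place of norm `5` with `j ≡ 1728`: anomalous iff `#Ṽ_w(𝔽_5) = 10`.**
[cite: IrelandRosen1990, Ch. 18 §4, Theorem 5] -/
theorem five_dvd_natCard_point_reductionAt_iff_of_valuation_j_sub_lt_one
    (hN : Ideal.absNorm w.asIdeal = 5) (hgood : V.HasGoodReductionAt w)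
    (hj : w.valuation F (V.j - 1728) < 1) :
    5 ∣ Nat.card (V.reductionAt w).toAffine.Point ↔ Nat.card (V.reductionAt w).toAffine.Point = 10 := by
  haveI : (V.reductionAt w).IsElliptic := isElliptic_reductionAt hgood
  haveI : Fact (Nat.Prime 5) := ⟨by norm_num⟩
  exact SpecialJ.five_dvd_natCard_point_iff_of_j_eq (V.reductionAt w)
    (natCard_residueField_adicCompletionIntegers_eq_of_absNorm w hN)
    (reductionAt_j_eq_of_valuation_lt_one V w hgood hj)

end NumberFieldPlace

/-! ### The (G)-cell: semistability defect `4` (Kodaira `III`, `III*`) -/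

section Gord

variable (W : WeierstrassCurve ℚ) [W.IsElliptic] [W.IsGloballyMinimal] (p : ℕ) [hp : Fact p.Prime]

/-- On the type-(G) locus, defect `4` forces `p ≡ 1 (mod 4)` (`p ≥ 5`): `e ∣ p − 1`
(`typeG_iff_not_subM_and_semistabilityIndex_dvd`, gen 2; Serre–Tate). So the defect-`4` (G)-pairs
live at `p ∈ {5, 13, 17, 29, 37, 41, 53, …}`. [folklore] -/
theorem four_dvd_sub_one_of_typeG_of_semistabilityIndex_eq_four (hp5 : 5 ≤ p) (hG : TypeG W p)
    (he : semistabilityIndex W p = 4) : 4 ∣ p - 1 :=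
  he ▸ ((typeG_iff_not_subM_and_semistabilityIndex_dvd W p hp5).mp hG).2

/-- **The trace law at every degree-one good place of a defect-`4` pair, `p ≡ 1 (mod 4)`**: for
`W/ℚ` globally minimal with `e_E(p) = semistabilityIndex W p = 4` (Kodaira `III`/`III*`), ANY number
field `F` and ANY place `w ∋ p` with `N(w) = p` at which `E_F` is good,
**`p + 1 − #Ẽ_w(𝔽_p) = 2u` with `u² + v² = p`** for some `u, v ∈ ℤ` (the census law `a_𝔭 = 2u`,
`p = u² + v²`, 265/265 rows). The reduction has `j̃ = 1728`
(`valuation_j_sub_lt_one_of_semistabilityIndex_eq_four`, gen 11).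
[cite: IrelandRosen1990, Ch. 18 §4, Theorem 5] -/
theorem exists_trace_eq_two_mul_and_sq_add_sq_reductionAt_of_semistabilityIndex_eq_four
    (hp1 : p % 4 = 1) (he : semistabilityIndex W p = 4) {F : Type} [Field F] [NumberField F]
    {w : HeightOneSpectrum (𝓞 F)} (hw : (p : 𝓞 F) ∈ w.asIdeal) (hN : Ideal.absNorm w.asIdeal = p)
    (hgood : (W.baseChange F).HasGoodReductionAt w) :
    ∃ u v : ℤ, ((p : ℤ) + 1 - Nat.card ((W.baseChange F).reductionAt w).toAffine.Point) = 2 * u ∧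
      u ^ 2 + v ^ 2 = p :=
  haveI : (W.baseChange F).IsElliptic := by rw [baseChange]; infer_instance
  exists_trace_eq_two_mul_and_sq_add_sq_reductionAt_of_valuation_j_sub_lt_one (W.baseChange F) w
    hp.out hp1 hN hgood (valuation_j_sub_lt_one_of_semistabilityIndex_eq_four W p
      (GaussianQuartic.five_le hp1) he hw hgood)

/-- Norm form of the defect-`4` trace law: **`(p + 1 − #Ẽ_w(𝔽_p))² + 4v² = 4p`** at every degree-one
good place `w ∋ p` of any number field (`e_E(p) = 4`, `p ≡ 1 (mod 4)`).
[cite: IrelandRosen1990, Ch. 18 §4, Theorem 5] -/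
theorem exists_trace_sq_add_four_mul_sq_reductionAt_of_semistabilityIndex_eq_four
    (hp1 : p % 4 = 1) (he : semistabilityIndex W p = 4) {F : Type} [Field F] [NumberField F]
    {w : HeightOneSpectrum (𝓞 F)} (hw : (p : 𝓞 F) ∈ w.asIdeal) (hN : Ideal.absNorm w.asIdeal = p)
    (hgood : (W.baseChange F).HasGoodReductionAt w) :
    ∃ v : ℤ, ((p : ℤ) + 1 - Nat.card ((W.baseChange F).reductionAt w).toAffine.Point) ^ 2 +
      4 * v ^ 2 = 4 * p := by
  obtain ⟨u, v, ha, huv⟩ :=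
    exists_trace_eq_two_mul_and_sq_add_sq_reductionAt_of_semistabilityIndex_eq_four W p hp1 he hw hN
      hgood
  exact ⟨v, by rw [ha]; linear_combination (4 : ℤ) * huv⟩

/-- **Defect-`4` additive pairs are anomalous at a degree-one good place above `p ≥ 5` ONLY at
`p = 5`, and then `#Ẽ_w(𝔽_5) = 10`.** Let `W` be a globally minimal model of `E/ℚ` with
`e_E(p) = 4` at `p ≥ 5`; for ANY number field `F` and ANY place `w ∋ p` of `F` with residue field
`𝔽_p` at which `E_F` has good reduction, `p ∣ #Ẽ_w(𝔽_p)` implies `p = 5` and `#Ẽ_w(𝔽_5) = 10`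
(gen 11's `not_dvd_natCard_point_reductionAt_of_semistabilityIndex_eq_four` is the case `p ≥ 7`).
Mazur 1972; Greenberg 1999 Thm. 4.1 (the hypothesis this decides). [cite: IrelandRosen1990, Ch. 18 §4, Theorem 5] -/
theorem eq_five_and_natCard_point_reductionAt_eq_ten_of_dvd_of_semistabilityIndex_eq_four
    (hp5 : 5 ≤ p) (he : semistabilityIndex W p = 4) {F : Type} [Field F] [NumberField F]
    {w : HeightOneSpectrum (𝓞 F)} (hw : (p : 𝓞 F) ∈ w.asIdeal) (hN : Ideal.absNorm w.asIdeal = p)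
    (hgood : (W.baseChange F).HasGoodReductionAt w)
    (hdvd : p ∣ Nat.card ((W.baseChange F).reductionAt w).toAffine.Point) :
    p = 5 ∧ Nat.card ((W.baseChange F).reductionAt w).toAffine.Point = 10 :=
  haveI : (W.baseChange F).IsElliptic := by rw [baseChange]; infer_instance
  eq_five_and_natCard_point_reductionAt_eq_ten_of_dvd_of_valuation_j_sub_lt_one (W.baseChange F) w
    hp.out hp5 hN hgood (valuation_j_sub_lt_one_of_semistabilityIndex_eq_four W p hp5 he hw hgood) hdvd

/-- **At `p = 5`, defect `4`: `#Ẽ_w(𝔽_5) ∈ {2, 4, 8, 10}` at every good place `w ∋ 5` of norm `5` of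
any number field** (census, the 233 defect-`4` rows at `5` over `F₀`: traces `−4: 70, −2: 64, 2: 51,
4: 48`). [cite: IrelandRosen1990, Ch. 18 §4, Theorem 5] -/
theorem natCard_point_reductionAt_mem_of_semistabilityIndex_eq_four_five [Fact (Nat.Prime 5)]
    (he : semistabilityIndex W 5 = 4) {F : Type} [Field F] [NumberField F]
    {w : HeightOneSpectrum (𝓞 F)} (hw : ((5 : ℕ) : 𝓞 F) ∈ w.asIdeal) (hN : Ideal.absNorm w.asIdeal = 5)
    (hgood : (W.baseChange F).HasGoodReductionAt w) :
    Nat.card ((W.baseChange F).reductionAt w).toAffine.Point = 2 ∨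
      Nat.card ((W.baseChange F).reductionAt w).toAffine.Point = 4 ∨
        Nat.card ((W.baseChange F).reductionAt w).toAffine.Point = 8 ∨
          Nat.card ((W.baseChange F).reductionAt w).toAffine.Point = 10 :=
  haveI : (W.baseChange F).IsElliptic := by rw [baseChange]; infer_instance
  natCard_point_reductionAt_mem_of_valuation_j_sub_lt_one_five (W.baseChange F) w hN hgood
    (valuation_j_sub_lt_one_of_semistabilityIndex_eq_four W 5 le_rfl he hw hgood)

/-- **At `p = 5`, defect `4`: anomalous at a good place of norm `5` iff `#Ẽ_w(𝔽_5) = 10`.**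
[cite: IrelandRosen1990, Ch. 18 §4, Theorem 5] -/
theorem five_dvd_natCard_point_reductionAt_iff_of_semistabilityIndex_eq_four [Fact (Nat.Prime 5)]
    (he : semistabilityIndex W 5 = 4) {F : Type} [Field F] [NumberField F]
    {w : HeightOneSpectrum (𝓞 F)} (hw : ((5 : ℕ) : 𝓞 F) ∈ w.asIdeal) (hN : Ideal.absNorm w.asIdeal = 5)
    (hgood : (W.baseChange F).HasGoodReductionAt w) :
    5 ∣ Nat.card ((W.baseChange F).reductionAt w).toAffine.Point ↔
      Nat.card ((W.baseChange F).reductionAt w).toAffine.Point = 10 :=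
  haveI : (W.baseChange F).IsElliptic := by rw [baseChange]; infer_instance
  five_dvd_natCard_point_reductionAt_iff_of_valuation_j_sub_lt_one (W.baseChange F) w hN hgood
    (valuation_j_sub_lt_one_of_semistabilityIndex_eq_four W 5 le_rfl he hw hgood)

/-- **On the (G)-cell, defect `4`: the trace law at EVERY place above `p` of every subfield of
`ℚ(ζ_p)`** (type (G) ⟹ `4 ∣ p − 1`; all residue degrees above `p` are `1`,
`absNorm_eq_of_intermediateField_cyclotomic`, gen 3). In particular over the minimal (G)-field `F₀`
(the quartic subfield) and over `ℚ(ζ_p)`: `a_𝔭 = 2u`, `p = u² + v²`.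
[cite: IrelandRosen1990, Ch. 18 §4, Theorem 5] -/
theorem exists_trace_eq_two_mul_and_sq_add_sq_reductionAt_intermediateField_of_semistabilityIndex_eq_four
    (hp5 : 5 ≤ p) (hG : TypeG W p) (he : semistabilityIndex W p = 4)
    {L : Type} [Field L] [NumberField L] [IsCyclotomicExtension {p} ℚ L] (F : IntermediateField ℚ L)
    (w : HeightOneSpectrum (𝓞 F)) (hw : (p : 𝓞 F) ∈ w.asIdeal)
    (hgood : (W.baseChange F).HasGoodReductionAt w) :
    ∃ u v : ℤ, ((p : ℤ) + 1 - Nat.card ((W.baseChange F).reductionAt w).toAffine.Point) = 2 * u ∧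
      u ^ 2 + v ^ 2 = p := by
  haveI : NumberField F := NumberField.of_module_finite ℚ F
  haveI : w.asIdeal.LiesOver (Ideal.span {(p : ℤ)}) := Ideal.liesOver_span_of_natCast_mem' hp.out hw
  have h4 := four_dvd_sub_one_of_typeG_of_semistabilityIndex_eq_four W p hp5 hG he
  have hp1 : p % 4 = 1 := by omega
  exact exists_trace_eq_two_mul_and_sq_add_sq_reductionAt_of_semistabilityIndex_eq_four W p hp1 he hw
    (absNorm_eq_of_intermediateField_cyclotomic p F w) hgood

/-- **On the (G)-cell, defect `4`: an ANOMALOUS place above `p ≥ 5` in a subfield of `ℚ(ζ_p)` forces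
`p = 5` and `#Ẽ_w(𝔽_5) = 10`** (census: the 70 anomalous defect-`4` rows all lie at `p = 5` with
`a_𝔭 = −4`). [cite: IrelandRosen1990, Ch. 18 §4, Theorem 5] -/
theorem eq_five_and_natCard_point_reductionAt_eq_ten_of_dvd_intermediateField_of_semistabilityIndex_eq_four
    (hp5 : 5 ≤ p) (he : semistabilityIndex W p = 4)
    {L : Type} [Field L] [NumberField L] [IsCyclotomicExtension {p} ℚ L] (F : IntermediateField ℚ L)
    (w : HeightOneSpectrum (𝓞 F)) (hw : (p : 𝓞 F) ∈ w.asIdeal)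
    (hgood : (W.baseChange F).HasGoodReductionAt w)
    (hdvd : p ∣ Nat.card ((W.baseChange F).reductionAt w).toAffine.Point) :
    p = 5 ∧ Nat.card ((W.baseChange F).reductionAt w).toAffine.Point = 10 := by
  haveI : NumberField F := NumberField.of_module_finite ℚ F
  haveI : w.asIdeal.LiesOver (Ideal.span {(p : ℤ)}) := Ideal.liesOver_span_of_natCast_mem' hp.out hw
  exact eq_five_and_natCard_point_reductionAt_eq_ten_of_dvd_of_semistabilityIndex_eq_four W p hp5 he hw
    (absNorm_eq_of_intermediateField_cyclotomic p F w) hgood hdvd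

/-- **Over `K = ℚ(ζ_p)` itself** (the field of the cell's line V19): for a defect-`4` pair and any
place `𝔭 ∋ p` of `K` at which `E_K` is good (there is exactly one, of norm `p`), `p ∣ #Ẽ_𝔭(𝔽_p)`
forces `p = 5 ∧ #Ẽ_𝔭(𝔽_5) = 10`; otherwise the anomalous factor `#Ẽ_𝔭(𝔽_p)[p^∞]` of Greenberg's
Thm. 4.1 is trivial (gen 11 for `p ≥ 7`). [cite: GreenbergLNM1716, Thm. 4.1] -/
theorem eq_five_and_natCard_point_reductionAt_eq_ten_of_dvd_cyclotomic_of_semistabilityIndex_eq_four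
    (hp5 : 5 ≤ p) (he : semistabilityIndex W p = 4) {K : Type} [Field K] [NumberField K]
    [IsCyclotomicExtension {p} ℚ K] {𝔭 : HeightOneSpectrum (𝓞 K)} (h𝔭 : (p : 𝓞 K) ∈ 𝔭.asIdeal)
    (hgood : (W.baseChange K).HasGoodReductionAt 𝔭)
    (hdvd : p ∣ Nat.card ((W.baseChange K).reductionAt 𝔭).toAffine.Point) :
    p = 5 ∧ Nat.card ((W.baseChange K).reductionAt 𝔭).toAffine.Point = 10 := by
  obtain ⟨𝔭₀, -, huniq, hN⟩ := exists_prime_over_prime p K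
  have h𝔭₀ : 𝔭 = 𝔭₀ := by
    have : 𝔭 ∈ ({𝔭₀} : Set (HeightOneSpectrum (𝓞 K))) := by
      rw [← huniq]; exact_mod_cast h𝔭
    exact this
  subst h𝔭₀
  exact eq_five_and_natCard_point_reductionAt_eq_ten_of_dvd_of_semistabilityIndex_eq_four W p hp5 he
    h𝔭 hN hgood hdvd

/-! ### Delbourgo's `ReductionNonAnomalous` on defect `4` at `p = 5`: one bit per pair -/

/-- **At `p = 5`, defect `4`: Delbourgo's predicate `ReductionNonAnomalous W 5` is exactly "no good
place above `5` of a subfield of `ℚ(ζ_5)` has `#Ẽ_w(𝔽_5) = 10`"** (gen 19's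
`reductionNonAnomalous_of_semistabilityIndex_eq_four` settles `p ≥ 7` outright; at `5` it is one bit
per pair — census 163/233 rows non-anomalous). [cite: Delbourgo2002, p. 39 (definition of ℓ_p(E))] -/
theorem reductionNonAnomalous_iff_forall_natCard_ne_ten_of_semistabilityIndex_eq_four
    [Fact (Nat.Prime 5)] (he : semistabilityIndex W 5 = 4) :
    Delbourgo2002.ReductionNonAnomalous W 5 ↔
      ∀ (L : Type) [Field L] [NumberField L] [IsCyclotomicExtension {5} ℚ L]
        (F : IntermediateField ℚ L) (w : HeightOneSpectrum (𝓞 F)),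
        ((5 : ℕ) : 𝓞 F) ∈ w.asIdeal → (W.baseChange F).HasGoodReductionAt w →
          Nat.card ((W.baseChange F).reductionAt w).toAffine.Point ≠ 10 := by
  constructor
  · intro h L _ _ _ F w hw hgood h10
    exact h L F w hw hgood (h10 ▸ (by norm_num : 5 ∣ 10))
  · intro h L _ _ _ F w hw hgood hdvd
    exact h L F w hw hgood
      (eq_five_and_natCard_point_reductionAt_eq_ten_of_dvd_intermediateField_of_semistabilityIndex_eq_four
        W 5 le_rfl he F w hw hgood hdvd).2

/-! ### The uniform norm-form law of the (G)-cell off defect `2` -/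

/-- **THE NORM-FORM LAW OF THE (G)-CELL OFF DEFECT `2`.** Let `W` be a globally minimal model of
`E/ℚ`, `p ≥ 5`, `(E, p)` of Delbourgo's type (G) with semistability defect `e_E(p) ∈ {3, 4, 6}`
(Kodaira `IV, IV*, III, III*, II, II*`). For ANY number field `F` and ANY place `w ∋ p` with
`N(w) = p` at which `E_F` is good, the trace `a_w = p + 1 − #Ẽ_w(𝔽_p)` satisfies
**`a_w² + d·m² = 4p` for some `m ∈ ℤ`, with `d = 3` if `3 ∣ e` and `d = 4` if `e = 4`**: the special
fibre has `j̃ = 0` (CM by `ℤ[ω]`) resp. `j̃ = 1728` (CM by `ℤ[i]`), type (G) gives `e ∣ p − 1`, and its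
Frobenius is an element of norm `p` of that order (gen 34's `…three_dvd_semistabilityIndex` law and
the defect-`4` law above). Census: 599/599 defect-`3`/`4`/`6` (G-ord) rows over `F₀`.
[cite: IrelandRosen1990, Ch. 18 §3 Theorem 4 and §4 Theorem 5] -/
theorem exists_trace_sq_add_mul_sq_reductionAt_of_typeG (hp5 : 5 ≤ p) (hG : TypeG W p)
    (he : semistabilityIndex W p = 3 ∨ semistabilityIndex W p = 4 ∨ semistabilityIndex W p = 6)
    {F : Type} [Field F] [NumberField F] {w : HeightOneSpectrum (𝓞 F)} (hw : (p : 𝓞 F) ∈ w.asIdeal)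
    (hN : Ideal.absNorm w.asIdeal = p) (hgood : (W.baseChange F).HasGoodReductionAt w) :
    ∃ d m : ℤ, (d = 3 ∧ 3 ∣ semistabilityIndex W p ∨ d = 4 ∧ semistabilityIndex W p = 4) ∧
      ((p : ℤ) + 1 - Nat.card ((W.baseChange F).reductionAt w).toAffine.Point) ^ 2 + d * m ^ 2 =
        4 * p := by
  have hdvd := ((typeG_iff_not_subM_and_semistabilityIndex_dvd W p hp5).mp hG).2
  rcases he with h3 | h4 | h6
  · have h3e : 3 ∣ semistabilityIndex W p := by rw [h3]
    obtain ⟨m, hm⟩ := exists_trace_sq_add_three_mul_sq_reductionAt_of_three_dvd_semistabilityIndex W p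
      hp5 (h3e.trans hdvd) h3e hw hN hgood
    exact ⟨3, m, Or.inl ⟨rfl, h3e⟩, by linear_combination hm⟩
  · have hp1 : p % 4 = 1 := by
      have h4' : 4 ∣ p - 1 := by rw [← h4]; exact hdvd
      omega
    obtain ⟨v, hv⟩ := exists_trace_sq_add_four_mul_sq_reductionAt_of_semistabilityIndex_eq_four W p
      hp1 h4 hw hN hgood
    exact ⟨4, v, Or.inr ⟨rfl, h4⟩, by linear_combination hv⟩
  · have h3e : 3 ∣ semistabilityIndex W p := by rw [h6]; norm_num
    obtain ⟨m, hm⟩ := exists_trace_sq_add_three_mul_sq_reductionAt_of_three_dvd_semistabilityIndex W p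
      hp5 (h3e.trans hdvd) h3e hw hN hgood
    exact ⟨3, m, Or.inl ⟨rfl, h3e⟩, by linear_combination hm⟩

/-- The same at EVERY place above `p` of every subfield of `ℚ(ζ_p)` (every (G)-field, the minimal
(G)-field `F₀`, and `ℚ(ζ_p)`): **`a_w² + d·m² = 4p`, `d ∈ {3, 4}` by defect.**
[cite: IrelandRosen1990, Ch. 18 §3 Theorem 4 and §4 Theorem 5] -/
theorem exists_trace_sq_add_mul_sq_reductionAt_intermediateField_of_typeG (hp5 : 5 ≤ p)
    (hG : TypeG W p)
    (he : semistabilityIndex W p = 3 ∨ semistabilityIndex W p = 4 ∨ semistabilityIndex W p = 6)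
    {L : Type} [Field L] [NumberField L] [IsCyclotomicExtension {p} ℚ L] (F : IntermediateField ℚ L)
    (w : HeightOneSpectrum (𝓞 F)) (hw : (p : 𝓞 F) ∈ w.asIdeal)
    (hgood : (W.baseChange F).HasGoodReductionAt w) :
    ∃ d m : ℤ, (d = 3 ∧ 3 ∣ semistabilityIndex W p ∨ d = 4 ∧ semistabilityIndex W p = 4) ∧
      ((p : ℤ) + 1 - Nat.card ((W.baseChange F).reductionAt w).toAffine.Point) ^ 2 + d * m ^ 2 =
        4 * p := by
  haveI : NumberField F := NumberField.of_module_finite ℚ F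
  haveI : w.asIdeal.LiesOver (Ideal.span {(p : ℤ)}) := Ideal.liesOver_span_of_natCast_mem' hp.out hw
  exact exists_trace_sq_add_mul_sq_reductionAt_of_typeG W p hp5 hG he hw
    (absNorm_eq_of_intermediateField_cyclotomic p F w) hgood

end Gord

end Summit.BirchSwinnertonDyer.Rank1Residual.Additive

end
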